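/-
Copyright: the b2b-balaban cell (near-miss cell 7), T⁴-continuum fan-out; row NE7b ROUND-2 swarm, seat
t4-ne7b-formalise-leaf-08 (gen 11) — row S12o «CONCAVE ENTROPY REPAIR» part (iii) (R-OWNER-23-15 (2), division of labour
journal l.17953), sibling 2∕3: END v3′ made GENERIC in the class-linear constant.  Released under the licence of the
surrounding project.
-/
import Summits.QuantumFields.BalabanUV.T4Continuum.Support.HistoryRealiseCellsRunMultEndP
import Summits.QuantumFields.BalabanUV.T4Continuum.Support.HistoryAssemblyMultInstanceTwin

/-!
# Realised run, END-A at the infrared threshold, GENERIC in the twin END's constant (row S12o (iii), sibling 2∕3)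

Summits-side support leaf of the T⁴-continuum cell (rung (B)+1 on a FINITE torus only; NOT infinite volume, NOT the
mass gap, NOT the Clay statement; NOT a proof of the spine estimate NE7b).  Row NE7b, route «COUNT», row S12o
«CONCAVE ENTROPY REPAIR» (R-OWNER-23-15).  THIS FILE is the generic twin of END v3′
`HistoryRealiseCellsRunMultEndP.hybridNE7_of_realisedDomainsRun_printedT3bP` (leaf-03 g3 ∕ leaf-05 g6): the class-linear
constant of row S6g′'s instance is no longer spelled out — the twin END's inequality enters as the HYPOTHESIS `htwin`
for an ARBITRARY `Θ₀`, and `hθJ` reads `Θ₀ + 8·2^d·log(2d+1) ≤ θ·P`.  Suppliers of `htwin`: the tree's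
`HistoryJoinsPlacedTwin.card_S_sortR_le_exp_pow` (then this END is END v3′ again — pattern: the fidelity
`example` of `HistoryAssemblyMultInstanceTwin`), or row S12o (ii)'s concave sibling with `ΘJc`, or any later
repair of the constant — with NO further copy of the END chain.  [folklore] re-lettering of OUR bookkeeping: the
statement is END v3′'s with four binder groups replaced, the proof END v3′'s with one lemma name changed; imports END v3′
(all letters BY NAME) + sibling 1; nothing is quoted from print, nothing printed is asserted, no `[cite:]` tag, no
`Prop`-valued fact minted, no definition; constants symbolic (c2∕c6); no landed file edited (c3) — a SIBLING module.

DISPLAYED, NOT DISCHARGED (as in END v3′): H3 (`RealisedDomainsR` + `hstep` + `hdis` + the cost∕price∕numerator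
readings), the flow side `BetaLowerH`∕`BetaUpperH`∕`SmallnessFor`∕`Tuned` (⇐ BetaPertHyp), `hir`, the profile level
`hP1`∕`hP`, the (B) side `Cor3With`, the moment bounds, NE7c `ShellWeightBound`, NE7 `ReindexedBudget`, four summable
rates, the class-linear slack `hslack` — PLUS `htwin` and `hθJ` in the generic letters.  Sibling 3
(`HistoryRealiseCellsRunMultEndPDTwin`) discharges `hdis` as END v3.1′ does.

HONEST: the END of record v3.1′ (p223694), the pinned END, the headline p224237 and its Prop are UNCHANGED; nothing of
H3 ∕ (B) ∕ BetaPertHyp or of the nine discharged; NE7b NOT proved; spine 0∕9.  HONEST DEPENDENCY (cell): continuum YM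
on T⁴ ⇐ BetaPertH ∧ nine spine estimates (0/9 proved); BetaPertH ⇐ (D1) ∧ (D4) ∧ CAP+tail; G-an2-4 gates asym, D1
and NE2/3/4.  This file changes none of it.
-/

open Finset MeasureTheory
open Literature.MathematicalPhysics.QuantumFieldTheory.Balaban1983to89
open T4PersistenceDictionary T4PersistentHistoryCount T4BankedInduction T4PrintedShapeBanking
open T4WeightBudget T4GlobalDenominator T4LiveClassFibration T4LiveStructureGas T4LiveGasToTerms T4RecordPriceSeam
open T4PartnerMultiplicity T4IndicatorShell T4MatchingAssembly T4MatchingClosure T4MatchingClosureSocket T4Continuum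
open T4StabilitySocket T4BranchingRecordsGas T4TaggedShapeBanking T4CanonicalMenus T4RenewalChains
open Summit.QuantumFields.BalabanUV.T4Continuum.PlacementBatch
open Summit.QuantumFields.BalabanUV.T4Continuum.PlacementSkeleton
open Summit.QuantumFields.BalabanUV.T4Continuum.CountThresholdUniform
open Summit.QuantumFields.BalabanUV.T4Continuum.CountThresholdExit
open Summit.QuantumFields.BalabanUV.T4Continuum.CountSeamJunction
open Summit.QuantumFields.BalabanUV.T4Continuum.LateMergers
open Summit.QuantumFields.BalabanUV.T4Continuum.HistoryFlow
open Summit.QuantumFields.BalabanUV.T4Continuum.HistoryRegeneration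
open Summit.QuantumFields.BalabanUV.T4Continuum.HistoryTables
open Summit.QuantumFields.BalabanUV.T4Continuum.HistoryAssemblyTrees
open Summit.QuantumFields.BalabanUV.T4Continuum.HistoryAssemblyTerms
open Summit.QuantumFields.BalabanUV.T4Continuum.HistoryAssemblyPedigree
open Summit.QuantumFields.BalabanUV.T4Continuum.HistoryConstants
open Summit.QuantumFields.BalabanUV.T4Continuum.HistoryGen
open Literature.MathematicalPhysics.QuantumFieldTheory.Balaban1983to89.B13ScaleTransfer
open Summit.QuantumFields.BalabanUV.T4Continuum.ZoneSkeleton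
open Summit.QuantumFields.BalabanUV.T4Continuum.HistorySocketTH
open Summit.QuantumFields.BalabanUV.T4Continuum.HistoryCaps
open Summit.QuantumFields.BalabanUV.T4Continuum.HistoryAssemblyPrice
open Summit.QuantumFields.BalabanUV.T4Continuum.HistoryBankingLE
open Summit.QuantumFields.BalabanUV.T4Continuum.HistoryExitLE
open Summit.QuantumFields.BalabanUV.T4Continuum.HistoryAssemblyTreesLE
open Summit.QuantumFields.BalabanUV.T4Continuum.HistoryAssemblyTermsLE
open Summit.QuantumFields.BalabanUV.T4Continuum.HistoryRealise
open Summit.QuantumFields.BalabanUV.T4Continuum.HistoryAssemblyRealiseLE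
open Summit.QuantumFields.BalabanUV.T4Continuum.HistoryAssemblyMult
open Summit.QuantumFields.BalabanUV.T4Continuum.HistoryAssemblyMultKey
open Summit.QuantumFields.BalabanUV.T4Continuum.HistoryAssemblyRealiseRun
open Summit.QuantumFields.BalabanUV.T4Continuum.HistoryAssemblyRealiseMult
open Summit.QuantumFields.BalabanUV.T4Continuum.HistoryZones
open Summit.QuantumFields.BalabanUV.T4Continuum.HistoryRealiseCells
open Summit.QuantumFields.BalabanUV.T4Continuum.HistoryRealiseCellsRun
open Summit.QuantumFields.BalabanUV.T4Continuum.HistoryAssemblyRealiseRunMult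

open Summit.QuantumFields.BalabanUV.T4Continuum.HistoryRealiseCellsRunMult
open Summit.QuantumFields.BalabanUV.T4Continuum.HistoryRealiseCellsRunMultP
open Summit.QuantumFields.BalabanUV.T4Continuum.HistoryRealiseCellsRunMultEnd
open Summit.QuantumFields.BalabanUV.T4Continuum.HistoryAssemblyMultInstance
open Summit.QuantumFields.BalabanUV.T4Continuum.HistoryJoinsPlacedMember
open Summit.QuantumFields.BalabanUV.T4Continuum.PlacementSkeleton
open Summit.QuantumFields.BalabanUV.T4Continuum.HistoryJoinsPlacedMult
open Summit.QuantumFields.BalabanUV.T4Continuum.HistoryRealiseDistinct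
open Summit.QuantumFields.BalabanUV.T4Continuum.HistoryRegionTemplates
open Summit.QuantumFields.BalabanUV.T4Continuum.HistoryCaps
open Summit.QuantumFields.BalabanUV.T4Continuum.HistoryZoneEvolve (cth)
open Literature.MathematicalPhysics.QuantumFieldTheory.Balaban1983to89.B16SProfile (DropCtl)
open Summit.QuantumFields.BalabanUV.T4Continuum.HistoryRealiseCellsRunMultEndP
open Summit.QuantumFields.BalabanUV.T4Continuum.HistoryAssemblyMultInstanceTwin

-- letters of the twin bound (as opened in `HistoryAssemblyMultInstance`)
open Finset
open Literature.MathematicalPhysics.QuantumFieldTheory.Balaban1983to89.B13ScaleTransfer (Pt FaceConnected)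
open T4PersistenceDictionary T4PrintedShapeBanking T4TaggedShapeBanking T4PartnerMultiplicity T4BranchingRecordsGas
open Summit.QuantumFields.BalabanUV.T4Continuum.ZoneTorus
open Summit.QuantumFields.BalabanUV.T4Continuum.HistoryAdmissible
open Summit.QuantumFields.BalabanUV.T4Continuum.HistoryJoins
open Summit.QuantumFields.BalabanUV.T4Continuum.HistoryJoinsAdm
open Summit.QuantumFields.BalabanUV.T4Continuum.HistoryAssemblyMultLetters
open Summit.QuantumFields.BalabanUV.T4Continuum.HistoryJoinsTemplates
open Summit.QuantumFields.BalabanUV.T4Continuum.HistoryJoinsPlacedZone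
open Summit.QuantumFields.BalabanUV.T4Continuum.HistoryJoinsPlacedValue
open Summit.QuantumFields.BalabanUV.T4Continuum.HistoryJoinsPlacedTwin
open Summit.QuantumFields.BalabanUV.T4Continuum.HistorySiblingEntropyBridge
open Summit.QuantumFields.BalabanUV.T4Continuum.HistoryZoneMassLawLevels
open Summit.QuantumFields.BalabanUV.T4Continuum.HistoryRenewalsCost

namespace Summit.QuantumFields.BalabanUV.T4Continuum.HistoryRealiseCellsRunMultEndPTwin

noncomputable section

section End

variable {F : T4Family} {G : Type*} [GaugeGroup G] [MeasurableSpace G] [HaarData G] [RegularGaugeGroup G]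
variable {α π : Type*} [DecidableEq α] [DecidableEq π]
variable {ι : Type*} [DecidableEq ι] {l₀ vol : ℝ} {K₀ : ℕ} {T : ℕ → Finset ι} {A A' shA shB : ℕ → ℝ → ι → ℝ}
  {dead dead' : ℕ → ℝ → ι → ℝ} {nup mup : ℕ → ℝ → ℝ} {Nup : ℝ}
  {Cc Rr CcRec RrRec : ℕ → ℝ → ι → ℝ} {ν u s₂ q₀ r s Wsh : ℕ → ℝ}

/-- **NE7b's COUNT EXIT — END-A AT THE INFRARED THRESHOLD, GENERIC IN THE TWIN END's CONSTANT** (row S12o (iii),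
sibling 2∕3): the tree's `HistoryRealiseCellsRunMultEndP.hybridNE7_of_realisedDomainsRun_printedT3bP` (END v3′) with the
binders {`hE₂ hE₃`, `sS hsS hsmall`, `θc hθc0 hθc1 hθcs`, `hθJ : ΘJ + … ≤ θ·P`} REPLACED by {`Θ₀`, `htwin` (the twin END's
conclusion shape at `Θ₀`, universally over cutoff ∕ term ∕ live component ∕ template capacity ∕ root data, under
`ConsistentTLE` and `step ≤ K`), `hθJ : Θ₀ + 8·2^d·log(2d+1) ≤ θ·P`}; every other binder and the conclusion VERBATIM;
proof = the tree's with `card_koccOf_le_exp ↦ HistoryAssemblyMultInstanceTwin.card_koccOf_le_exp_of_twin`. [folklore] -/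
theorem hybridNE7_of_realisedDomainsRun_printedT3bP_of_twin (D : FiniteEpsData F G) {C : T4PrintedShapeBanking.Consts}
    {O : PrintedO1s}
    {rr : ℕ} {β₀ : ℝ} (h : ThresholdOK C F.L rr β₀) (hμ : 0 < C.μ) (d n : ℕ)
    (hκ₁ : (d : ℝ) * Real.log F.L + 2 * Real.log 2 ≤ C.κ₁) (hE₀ : Real.log (2 + birthMass C) ≤ C.E₀)
    -- the flow side (⇐ BetaPertH, displayed) and tuning
    {γ₀ γb b β' : ℝ} {pe : ℕ} (hb : 0 ≤ b) (hlo : FlowStep.BetaLowerH b γ₀ D.βfun)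
    (hhi : FlowStep.BetaUpperH β' γ₀ D.βfun) (hγ : γb ≤ γ₀) (hγβ : γb ^ 2 * β' < 1)
    (S : B14FlowStep.SmallnessFor γb β' β₀ F.L pe) (hp₀ : C.p₀ ≤ pe) (hrr : rr ≤ pe) (hβ : β₀ ≤ 1 / 2)
    {g : ℝ} {g₀ : ℕ → ℝ} (ht : D.Tuned γb g g₀)
    (hir : irThresholdTLE C F.L rr β₀ ≤ Real.log (g ^ 2)⁻¹)
    -- row S12j: a displayed profile LEVEL `P ≥ 1` below `p₀(g_K(s))` along every run (in the pinned ∕ apex form it is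
    -- DISCHARGED from the infrared threshold: `p₀` at the threshold) — the class-linear slack is read AT THIS LEVEL
    {P : ℝ} (hP1 : 1 ≤ P)
    (hP : ∀ K, K₀ ≤ K → ∀ s, s ≤ K → P ≤ p0Profile C.A₀ C.p₀ ((D.C ⟨K, F.m, g₀ K⟩).flow.g s))
    -- the (B) side
    (hsign : B16.SignConventions D.C) {γB : ℝ} {em ep : ℝ → ℝ} (hcor : B16.Cor3With D.C γB em ep) (hγB : γb ≤ γB)
    {obs : (K : ℕ) → GaugeField (F.P K) 0 G → ℝ} {B : ℝ}
    (hobs : ∀ K, Measurable (obs K)) (hbd : ∀ K U, |obs K U| ≤ B)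
    (hα : ∀ K t, |t| ≤ l₀ → K₀ ≤ K →
      ∫ U, Real.exp (t * obs K U) * D.dens K (g₀ K) 0 U ∂fieldMeasure (F.P K) 0 G ≤ ∑ τ ∈ T K, A K t τ)
    (hα' : ∀ K t, |t| ≤ l₀ → K₀ ≤ K →
      ∫ U, Real.exp (t * obs (K + 1) U) * D.dens (K + 1) (g₀ (K + 1)) 0 U ∂fieldMeasure (F.P (K + 1)) 0 G ≤
        ∑ τ ∈ T K, A' K t τ)
    {c₀ n₁ : ℝ} (hc₀ : 0 < c₀) (hfloor : ∀ K, K₀ ≤ K → c₀ ≤ smallFieldMass D K (g₀ K))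
    (hfloor' : ∀ K, K₀ ≤ K → c₀ ≤ smallFieldMass D (K + 1) (g₀ (K + 1)))
    (hsites : ∀ K, K₀ ≤ K → ((D.C ⟨K, F.m, g₀ K⟩).numSites K : ℝ) ≤ n₁)
    (hsites' : ∀ K, K₀ ≤ K → ((D.C ⟨K + 1, F.m, g₀ (K + 1)⟩).numSites (K + 1) : ℝ) ≤ n₁)
    (hNup : 0 ≤ Nup) (hnup : ∀ K t, |t| ≤ l₀ → K₀ ≤ K → 0 ≤ nup K t ∧ nup K t ≤ Nup)
    (hmup : ∀ K t, |t| ≤ l₀ → K₀ ≤ K → 0 ≤ mup K t ∧ mup K t ≤ Nup)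
    -- the (2.5) side condition on the size function
    (R : ℕ → ℕ → ℕ) (hR : ∀ K s, s ≤ K → B14.IsRj F.L rr ((D.C ⟨K, F.m, g₀ K⟩).flow.g s) (R K s))
    -- the side conditions of the geometric lemmas (row S1b): torus side, window constant, sizes (NO drop control)
    (hL4 : 4 ≤ F.L) (hn₁ : 13 ≤ C.n₁) (hR1 : ∀ K, K₀ ≤ K → ∀ t, 1 ≤ R K t)
    -- H3: the terms read as pedigrees REALISED BY THE RUN'S OWN PROFILE with their DOMAINS (root cells := `cellOfR`)
    (ped : ℕ → ι → Pedigree α π) (cellP : ℕ → ι → π → Pt d × Finset (Pt d)) (liveC : ℕ → ι → Finset α)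
    (Zd : ℕ → ι → α → Finset (Pt d)) (H : RealisedDomainsR F.L (runProfile F.L R) n K₀ R T ped cellP liveC Zd)
    (hn : 0 < n)
    -- H3: live components are dated no later than the cutoff; the bad terms' live components have DUPLICATE-FREE
    -- birth-value multisets (R-OWNER-23-6, letters of record `physV`)
    (hstep : ∀ K, K₀ ≤ K → ∀ τ ∈ T K, ∀ c ∈ liveC K τ, (ped K τ).step c ≤ K)
    (hdis : ∀ K, K₀ ≤ K → ∀ τ ∈ badTerms (memOf ped liveC (cellOfR n F.L (runProfile F.L R) ped cellP)) jhalf T K,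
      ∀ c ∈ liveC K τ, ((physV n F.L hn (Nat.lt_of_lt_of_le Nat.zero_lt_two (two_le_L F))
        (fun K => tcap d (dcapOf Prod.fst T (memOf ped liveC (cellOfR n F.L (runProfile F.L R) ped cellP)) K))
        (fun K => one_le_tcap d (dcapOf Prod.fst T (memOf ped liveC (cellOfR n F.L (runProfile F.L R) ped cellP)) K)) (runProfile F.L R) ped cellP) K τ c).Nodup)
    -- the class-linear slack: `C.a + θ ≤ ½γ₀A₁²` pays the factor `e^{θ·birthLinT}` of the slot multiplicity
    {θ : ℝ} (hθ : 0 ≤ θ) (hslack : C.a + θ ≤ O.γ₀ * O.A₁ ^ 2 / 2)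
    -- row S6g′'s INSTANCE, GENERIC (row S12o (iii)): THE TWIN BOUND AS A HYPOTHESIS for an arbitrary class-linear
    -- constant `Θ₀` (the tree's `ΘJ d sS θc` via `HistoryJoinsPlacedTwin.card_S_sortR_le_exp_pow`, or the concave
    -- sibling `ΘJc` of row S12o (ii)) — the stride ∕ decay arithmetic and the floor signs live with its supplier —
    -- and `θ·P` above `Θ₀` + the root-template slope (row S12j: the demand is on the coupling window)
    {Θ₀ : ℝ}
    (htwin : ∀ K, K₀ ≤ K → ∀ τ ∈ T K, ∀ c ∈ liveC K τ,
      ConsistentTLE Prod.fst C K (R K) ((ped K τ).genT c) → (ped K τ).step c ≤ K →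
      ∀ (Mz Dz : ℕ) (c₀ : TCell d (n * F.L ^ K) × Template d Mz)
        (ρ : (Addr Dz → TCell d (n * F.L ^ K) × Template d Mz) → ℕ) (z : TCell d (n * F.L ^ K) × Template d Mz),
      ((HistoryJoinsAdm.S (zoneP n F.L K (levelOf (runProfile F.L R K) K) 32 c₀) ρ c₀ PEv.step
          ((ped K τ).sortR.gen c) z).card : ℝ) ≤
        Real.exp (Θ₀ * bsum (fun b => ((b.fat : ℕ) : ℝ) + 1) ((ped K τ).gen c) +
            8 / C.E₂ * totalCostT Prod.fst C K (R K) ((ped K τ).genT c)) *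
          (((F.L : ℝ) ^ d) * Real.exp 4) ^ partnerAges PEv.step ((ped K τ).gen c))
    (hθJ : Θ₀ + 8 * 2 ^ d * Real.log (2 * d + 1) ≤ θ * P)
    -- H3: realised per-step costs of the live members, read below the model's booked cost (reading (ID-a))
    (κ κ' : ℕ → (Fin d → ℕ) × Gen (Lab α π) → Gen (Lab α π) → ℕ → ℝ)
    (hκ : ∀ K, K₀ ≤ K → ∀ τ ∈ badTerms (memOf ped liveC (cellOfR n F.L (runProfile F.L R) ped cellP)) jhalf T K, ∀ q ∈ memOf ped liveC (cellOfR n F.L (runProfile F.L R) ped cellP) K τ,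
      ∀ m ∈ life (padW (dictWT Prod.fst (R K) C.n₁) 0) q.2,
        κ K q q.2 m ≤ costT Prod.fst C K (R K) q.2 m)
    (hκ' : ∀ K, K₀ ≤ K → ∀ τ ∈ badTerms (memOf ped liveC (cellOfR n F.L (runProfile F.L R) ped cellP)) jhalf T K, ∀ q ∈ memOf ped liveC (cellOfR n F.L (runProfile F.L R) ped cellP) K τ,
      ∀ m ∈ life (padW (dictWT Prod.fst (R K) C.n₁) 0) q.2,
        κ' K q q.2 m ≤ costT Prod.fst C K (R K) q.2 m)
    -- H3: the per-term price sentence over the named members in PRINT's currency, discounted by the allowance; the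
    -- live price of the PHYSICAL member family; both runs
    {FcM RfM FcM' RfM' : ℕ → Finset ((Fin d → ℕ) × Gen PEv × Multiset (PEv × ((Fin d → ℕ) × Finset (Pt d)))) → ℝ}
    (hPM : ∀ K t, |t| ≤ l₀ → K₀ ≤ K → ∀ τ ∈ badTerms (memOf ped liveC (cellOfR n F.L (runProfile F.L R) ped cellP)) jhalf T K,
      FcM K (kmemOf ped liveC (cellOfR n F.L (runProfile F.L R) ped cellP) (physV n F.L hn (Nat.lt_of_lt_of_le Nat.zero_lt_two (two_le_L F))
        (fun K => tcap d (dcapOf Prod.fst T (memOf ped liveC (cellOfR n F.L (runProfile F.L R) ped cellP)) K))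
        (fun K => one_le_tcap d (dcapOf Prod.fst T (memOf ped liveC (cellOfR n F.L (runProfile F.L R) ped cellP)) K)) (runProfile F.L R) ped cellP) K τ) * RfM K (kmemOf ped liveC (cellOfR n F.L (runProfile F.L R) ped cellP) (physV n F.L hn (Nat.lt_of_lt_of_le Nat.zero_lt_two (two_le_L F))
        (fun K => tcap d (dcapOf Prod.fst T (memOf ped liveC (cellOfR n F.L (runProfile F.L R) ped cellP)) K))
        (fun K => one_le_tcap d (dcapOf Prod.fst T (memOf ped liveC (cellOfR n F.L (runProfile F.L R) ped cellP)) K)) (runProfile F.L R) ped cellP) K τ) ≤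
        ∏ q ∈ memOf ped liveC (cellOfR n F.L (runProfile F.L R) ped cellP) K τ,
          pshapeTH Prod.fst O C 1 1 (R K) (D.C ⟨K, F.m, g₀ K⟩).flow.g 0 (κ K q) q.2 * Real.exp (-(8 / C.E₂ * totalCostT Prod.fst C K (R K) q.2 + 4 * (partnerAges (PEv.step ∘ Prod.fst) q.2 : ℝ))))
    (hPM' : ∀ K t, |t| ≤ l₀ → K₀ ≤ K → ∀ τ ∈ badTerms (memOf ped liveC (cellOfR n F.L (runProfile F.L R) ped cellP)) jhalf T K,
      FcM' K (kmemOf ped liveC (cellOfR n F.L (runProfile F.L R) ped cellP) (physV n F.L hn (Nat.lt_of_lt_of_le Nat.zero_lt_two (two_le_L F))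
        (fun K => tcap d (dcapOf Prod.fst T (memOf ped liveC (cellOfR n F.L (runProfile F.L R) ped cellP)) K))
        (fun K => one_le_tcap d (dcapOf Prod.fst T (memOf ped liveC (cellOfR n F.L (runProfile F.L R) ped cellP)) K)) (runProfile F.L R) ped cellP) K τ) * RfM' K (kmemOf ped liveC (cellOfR n F.L (runProfile F.L R) ped cellP) (physV n F.L hn (Nat.lt_of_lt_of_le Nat.zero_lt_two (two_le_L F))
        (fun K => tcap d (dcapOf Prod.fst T (memOf ped liveC (cellOfR n F.L (runProfile F.L R) ped cellP)) K))
        (fun K => one_le_tcap d (dcapOf Prod.fst T (memOf ped liveC (cellOfR n F.L (runProfile F.L R) ped cellP)) K)) (runProfile F.L R) ped cellP) K τ) ≤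
        ∏ q ∈ memOf ped liveC (cellOfR n F.L (runProfile F.L R) ped cellP) K τ,
          pshapeTH Prod.fst O C 1 1 (R K) (D.C ⟨K, F.m, g₀ K⟩).flow.g 0 (κ' K q) q.2 * Real.exp (-(8 / C.E₂ * totalCostT Prod.fst C K (R K) q.2 + 4 * (partnerAges (PEv.step ∘ Prod.fst) q.2 : ℝ))))
    -- H3: the remaining `Regeneration` numerator readings, over the PHYSICAL member families of the bad terms
    (upM : ∀ K t, |t| ≤ l₀ → K₀ ≤ K →
      ∀ k ∈ badGMems (memOf ped liveC (cellOfR n F.L (runProfile F.L R) ped cellP)) jhalf T (kmemOf ped liveC (cellOfR n F.L (runProfile F.L R) ped cellP) (physV n F.L hn (Nat.lt_of_lt_of_le Nat.zero_lt_two (two_le_L F))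
        (fun K => tcap d (dcapOf Prod.fst T (memOf ped liveC (cellOfR n F.L (runProfile F.L R) ped cellP)) K))
        (fun K => one_le_tcap d (dcapOf Prod.fst T (memOf ped liveC (cellOfR n F.L (runProfile F.L R) ped cellP)) K)) (runProfile F.L R) ped cellP)) K,
        ∀ τ ∈ fibre (kmemOf ped liveC (cellOfR n F.L (runProfile F.L R) ped cellP) (physV n F.L hn (Nat.lt_of_lt_of_le Nat.zero_lt_two (two_le_L F))
        (fun K => tcap d (dcapOf Prod.fst T (memOf ped liveC (cellOfR n F.L (runProfile F.L R) ped cellP)) K))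
        (fun K => one_le_tcap d (dcapOf Prod.fst T (memOf ped liveC (cellOfR n F.L (runProfile F.L R) ped cellP)) K)) (runProfile F.L R) ped cellP)) T K k, A K t τ ≤ dead K t τ * FcM K k * nup K t)
    (deadM_nonneg : ∀ K t, |t| ≤ l₀ → K₀ ≤ K →
      ∀ k ∈ badGMems (memOf ped liveC (cellOfR n F.L (runProfile F.L R) ped cellP)) jhalf T (kmemOf ped liveC (cellOfR n F.L (runProfile F.L R) ped cellP) (physV n F.L hn (Nat.lt_of_lt_of_le Nat.zero_lt_two (two_le_L F))
        (fun K => tcap d (dcapOf Prod.fst T (memOf ped liveC (cellOfR n F.L (runProfile F.L R) ped cellP)) K))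
        (fun K => one_le_tcap d (dcapOf Prod.fst T (memOf ped liveC (cellOfR n F.L (runProfile F.L R) ped cellP)) K)) (runProfile F.L R) ped cellP)) K,
        ∀ τ ∈ fibre (kmemOf ped liveC (cellOfR n F.L (runProfile F.L R) ped cellP) (physV n F.L hn (Nat.lt_of_lt_of_le Nat.zero_lt_two (two_le_L F))
        (fun K => tcap d (dcapOf Prod.fst T (memOf ped liveC (cellOfR n F.L (runProfile F.L R) ped cellP)) K))
        (fun K => one_le_tcap d (dcapOf Prod.fst T (memOf ped liveC (cellOfR n F.L (runProfile F.L R) ped cellP)) K)) (runProfile F.L R) ped cellP)) T K k, 0 ≤ dead K t τ)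
    (resumM : ∀ K t, |t| ≤ l₀ → K₀ ≤ K →
      ∀ k ∈ badGMems (memOf ped liveC (cellOfR n F.L (runProfile F.L R) ped cellP)) jhalf T (kmemOf ped liveC (cellOfR n F.L (runProfile F.L R) ped cellP) (physV n F.L hn (Nat.lt_of_lt_of_le Nat.zero_lt_two (two_le_L F))
        (fun K => tcap d (dcapOf Prod.fst T (memOf ped liveC (cellOfR n F.L (runProfile F.L R) ped cellP)) K))
        (fun K => one_le_tcap d (dcapOf Prod.fst T (memOf ped liveC (cellOfR n F.L (runProfile F.L R) ped cellP)) K)) (runProfile F.L R) ped cellP)) K,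
        ∑ τ ∈ fibre (kmemOf ped liveC (cellOfR n F.L (runProfile F.L R) ped cellP) (physV n F.L hn (Nat.lt_of_lt_of_le Nat.zero_lt_two (two_le_L F))
        (fun K => tcap d (dcapOf Prod.fst T (memOf ped liveC (cellOfR n F.L (runProfile F.L R) ped cellP)) K))
        (fun K => one_le_tcap d (dcapOf Prod.fst T (memOf ped liveC (cellOfR n F.L (runProfile F.L R) ped cellP)) K)) (runProfile F.L R) ped cellP)) T K k, dead K t τ ≤ RfM K k)
    (FM_nonneg : ∀ K t, |t| ≤ l₀ → K₀ ≤ K →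
      ∀ k ∈ badGMems (memOf ped liveC (cellOfR n F.L (runProfile F.L R) ped cellP)) jhalf T (kmemOf ped liveC (cellOfR n F.L (runProfile F.L R) ped cellP) (physV n F.L hn (Nat.lt_of_lt_of_le Nat.zero_lt_two (two_le_L F))
        (fun K => tcap d (dcapOf Prod.fst T (memOf ped liveC (cellOfR n F.L (runProfile F.L R) ped cellP)) K))
        (fun K => one_le_tcap d (dcapOf Prod.fst T (memOf ped liveC (cellOfR n F.L (runProfile F.L R) ped cellP)) K)) (runProfile F.L R) ped cellP)) K, 0 ≤ FcM K k)
    (upM' : ∀ K t, |t| ≤ l₀ → K₀ ≤ K →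
      ∀ k ∈ badGMems (memOf ped liveC (cellOfR n F.L (runProfile F.L R) ped cellP)) jhalf T (kmemOf ped liveC (cellOfR n F.L (runProfile F.L R) ped cellP) (physV n F.L hn (Nat.lt_of_lt_of_le Nat.zero_lt_two (two_le_L F))
        (fun K => tcap d (dcapOf Prod.fst T (memOf ped liveC (cellOfR n F.L (runProfile F.L R) ped cellP)) K))
        (fun K => one_le_tcap d (dcapOf Prod.fst T (memOf ped liveC (cellOfR n F.L (runProfile F.L R) ped cellP)) K)) (runProfile F.L R) ped cellP)) K,
        ∀ τ ∈ fibre (kmemOf ped liveC (cellOfR n F.L (runProfile F.L R) ped cellP) (physV n F.L hn (Nat.lt_of_lt_of_le Nat.zero_lt_two (two_le_L F))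
        (fun K => tcap d (dcapOf Prod.fst T (memOf ped liveC (cellOfR n F.L (runProfile F.L R) ped cellP)) K))
        (fun K => one_le_tcap d (dcapOf Prod.fst T (memOf ped liveC (cellOfR n F.L (runProfile F.L R) ped cellP)) K)) (runProfile F.L R) ped cellP)) T K k, A' K t τ ≤ dead' K t τ * FcM' K k * mup K t)
    (deadM'_nonneg : ∀ K t, |t| ≤ l₀ → K₀ ≤ K →
      ∀ k ∈ badGMems (memOf ped liveC (cellOfR n F.L (runProfile F.L R) ped cellP)) jhalf T (kmemOf ped liveC (cellOfR n F.L (runProfile F.L R) ped cellP) (physV n F.L hn (Nat.lt_of_lt_of_le Nat.zero_lt_two (two_le_L F))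
        (fun K => tcap d (dcapOf Prod.fst T (memOf ped liveC (cellOfR n F.L (runProfile F.L R) ped cellP)) K))
        (fun K => one_le_tcap d (dcapOf Prod.fst T (memOf ped liveC (cellOfR n F.L (runProfile F.L R) ped cellP)) K)) (runProfile F.L R) ped cellP)) K,
        ∀ τ ∈ fibre (kmemOf ped liveC (cellOfR n F.L (runProfile F.L R) ped cellP) (physV n F.L hn (Nat.lt_of_lt_of_le Nat.zero_lt_two (two_le_L F))
        (fun K => tcap d (dcapOf Prod.fst T (memOf ped liveC (cellOfR n F.L (runProfile F.L R) ped cellP)) K))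
        (fun K => one_le_tcap d (dcapOf Prod.fst T (memOf ped liveC (cellOfR n F.L (runProfile F.L R) ped cellP)) K)) (runProfile F.L R) ped cellP)) T K k, 0 ≤ dead' K t τ)
    (resumM' : ∀ K t, |t| ≤ l₀ → K₀ ≤ K →
      ∀ k ∈ badGMems (memOf ped liveC (cellOfR n F.L (runProfile F.L R) ped cellP)) jhalf T (kmemOf ped liveC (cellOfR n F.L (runProfile F.L R) ped cellP) (physV n F.L hn (Nat.lt_of_lt_of_le Nat.zero_lt_two (two_le_L F))
        (fun K => tcap d (dcapOf Prod.fst T (memOf ped liveC (cellOfR n F.L (runProfile F.L R) ped cellP)) K))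
        (fun K => one_le_tcap d (dcapOf Prod.fst T (memOf ped liveC (cellOfR n F.L (runProfile F.L R) ped cellP)) K)) (runProfile F.L R) ped cellP)) K,
        ∑ τ ∈ fibre (kmemOf ped liveC (cellOfR n F.L (runProfile F.L R) ped cellP) (physV n F.L hn (Nat.lt_of_lt_of_le Nat.zero_lt_two (two_le_L F))
        (fun K => tcap d (dcapOf Prod.fst T (memOf ped liveC (cellOfR n F.L (runProfile F.L R) ped cellP)) K))
        (fun K => one_le_tcap d (dcapOf Prod.fst T (memOf ped liveC (cellOfR n F.L (runProfile F.L R) ped cellP)) K)) (runProfile F.L R) ped cellP)) T K k, dead' K t τ ≤ RfM' K k)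
    (FM'_nonneg : ∀ K t, |t| ≤ l₀ → K₀ ≤ K →
      ∀ k ∈ badGMems (memOf ped liveC (cellOfR n F.L (runProfile F.L R) ped cellP)) jhalf T (kmemOf ped liveC (cellOfR n F.L (runProfile F.L R) ped cellP) (physV n F.L hn (Nat.lt_of_lt_of_le Nat.zero_lt_two (two_le_L F))
        (fun K => tcap d (dcapOf Prod.fst T (memOf ped liveC (cellOfR n F.L (runProfile F.L R) ped cellP)) K))
        (fun K => one_le_tcap d (dcapOf Prod.fst T (memOf ped liveC (cellOfR n F.L (runProfile F.L R) ped cellP)) K)) (runProfile F.L R) ped cellP)) K, 0 ≤ FcM' K k)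
    -- the seam's other inputs
    (hSh : ShellWeightBound l₀ T A A' shA shB Wsh)
    (hTB : ReindexedBudget l₀ vol T (fun K t τ => A K t τ - shA K t τ) (fun K t τ => A' K t τ - shB K t τ)
      (badOfClass (bstrOf Prod.fst (memOf ped liveC (cellOfR n F.L (runProfile F.L R) ped cellP))) T
        (fun K _ => badClasses Prod.fst (memOf ped liveC (cellOfR n F.L (runProfile F.L R) ped cellP)) jhalf T K)) Cc Rr CcRec RrRec ν u s₂ q₀ r s)
    (hr : Summable r) (hu : Summable u) (hs : Summable s) (hs₂ : Summable s₂) :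
    ∃ K₁ K₂, K₀ ≤ K₁ ∧ HybridNE7 l₀ vol (fun K => T (K₁ + (K₂ + K))) (fun K => A (K₁ + (K₂ + K)))
      (fun K => A' (K₁ + (K₂ + K)))
      (fun K => badOfClass (bstrOf Prod.fst (memOf ped liveC (cellOfR n F.L (runProfile F.L R) ped cellP))) T
        (fun K _ => badClasses Prod.fst (memOf ped liveC (cellOfR n F.L (runProfile F.L R) ped cellP)) jhalf T K) (K₁ + (K₂ + K)))
      (fun K => constOf l₀ B (max (em g) 0) n₁ c₀ Nup *
        recordsBudget (birthMass C) C.κ₁ ((n : ℝ) ^ d) ((F.L : ℝ) ^ d) (Real.log 2) jhalf (K₁ + (K₂ + K)))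
      (fun K => shA (K₁ + (K₂ + K))) (fun K => shB (K₁ + (K₂ + K))) (fun K => Wsh (K₁ + (K₂ + K)))
      (fun K => (r (K₁ + (K₂ + K)) + u (K₁ + (K₂ + K))) + (s (K₁ + (K₂ + K)) + s₂ (K₁ + (K₂ + K)))) := by
  -- the run's profile is stepwise non-increasing (from the flow below the cutoff, constant beyond) and drop-controlled
  have hprof : ∀ K, K₀ ≤ K → ∀ t, runProfile F.L R K (t + 1) ≤ runProfile F.L R K t := fun K _ t => by
    by_cases htK : t < K
    · exact runProfile_succ_le D hb hlo hhi hγ hγβ S ht R hR K t htK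
    · show expOf F.L (R K) (min (t + 1) K) ≤ expOf F.L (R K) (min t K)
      rw [min_eq_right (by omega), min_eq_right (by omega)]
  have hdropR : ∀ K, K₀ ≤ K → ∀ m, DropCtl (runProfile F.L R K) m := fun K _ =>
    dropCtl_runProfile D hb hlo hhi hγ hγβ S hrr hβ ht R hR K
  have hMf : ∀ K, K₀ ≤ K → ∀ τ ∈ T K, ∀ c ∈ liveC K τ, ∀ bz ∈ ((ped K τ).toPGen (cellP K τ) c).pbirths,
      tcap d bz.1.fat ≤ (fun K => tcap d (dcapOf Prod.fst T (memOf ped liveC (cellOfR n F.L (runProfile F.L R) ped cellP)) K)) K :=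
    fun K hK τ hτ c hc bz hbz => tcap_mono d (le_of_lt (fat_lt_dcapOf_of_mem_pbirths
      (fun K hK τ hτ => H.renew_step K hK τ hτ) (cellOfR n F.L (runProfile F.L R) ped cellP) hK hτ hc hbz))
  exact hybridNE7_of_realisedDomainsRun_printedMultP D h hμ d n hκ₁ hE₀ hb hlo hhi hγ hγβ S hp₀ hrr hβ ht hir hP1 hP
    hsign hcor
    hγB hobs hbd hα hα' hc₀ hfloor hfloor' hsites hsites' hNup hnup hmup R hR hL4 hn₁ hR1 ped cellP liveC Zd H hn
    (physV n F.L hn (Nat.lt_of_lt_of_le Nat.zero_lt_two (two_le_L F))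
        (fun K => tcap d (dcapOf Prod.fst T (memOf ped liveC (cellOfR n F.L (runProfile F.L R) ped cellP)) K))
        (fun K => one_le_tcap d (dcapOf Prod.fst T (memOf ped liveC (cellOfR n F.L (runProfile F.L R) ped cellP)) K)) (runProfile F.L R) ped cellP)
    hθ hslack (Λm := (F.L : ℝ) ^ d) (Λr := 1) (by positivity) zero_le_one (by rw [mul_one]) κ κ' hκ hκ'
    (fun K q => (8 / C.E₂ * totalCostT Prod.fst C K (R K) q.2 + 4 * (partnerAges (PEv.step ∘ Prod.fst) q.2 : ℝ)))
    (fun K hK τ hτ c hc => card_koccOf_le_exp_of_twin hn (Nat.lt_of_lt_of_le Nat.zero_lt_two (two_le_L F)) hL4 hn₁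
      (fun K => one_le_tcap d (dcapOf Prod.fst T (memOf ped liveC (cellOfR n F.L (runProfile F.L R) ped cellP)) K)) hprof hdropR hR1 H hstep hMf jhalf hdis
      (fun K hK τ hτ c hc hcons hKs Mz Dz c₀ ρ z => htwin K hK τ hτ c hc hcons hKs Mz Dz c₀ ρ z) hθJ hK hτ hc)
    hPM hPM' upM deadM_nonneg resumM FM_nonneg upM' deadM'_nonneg resumM' FM'_nonneg hSh hTB hr hu hs hs₂

end End

end

end Summit.QuantumFields.BalabanUV.T4Continuum.HistoryRealiseCellsRunMultEndPTwin
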